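import Summits.CriticalPhenomena.PercolationContinuityZ3.Theorems.PercNearOneGluingNoHeavyQuantFarGate3CertNFits
import HarnessLib

/-!
# QUANT lane R8, front "FAR beyond trees", layer one — THE DEGREE-THREE GATE AT THE OBSERVER, LXVI-b: generic box-certificate engine over kernel N — EVALUATION
# (`ev (polyOf S d m m') = Σ condE`, the record bridge `toP4 (polyOfV …) = polyOf …`, and the kernel step `pairOk ⟹ ev (polyOf …) ≤ 0` on the box)

builds on p205010 (kernel theorem, internal audit signed; external expert review pending)

Support file (`--supports stmt-CriticalPhenomena-4575`), seat `prim-quant-p1` (gen 35); memo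
`run/shared/lean/prim/quant/prim-quant-p1-g35/FOR-LEAD-GATE3-PINCH.md`.  Files LXIII–LXVI-a only; standard axioms; no sorries; no definitions except the
real bookkeeping function `condE` (pattern of file L-c `ChartCCertE`).
[this work].
-/

namespace Summit.CriticalPhenomena.PercolationContinuityZ3.Theorems

namespace Quant

namespace CertN

open BoxPolyP

section Real

variable (y a b c : ℝ) (d : Cert)

variable (S : Spec)

/-- The form tables fit their declared degrees under `specOk`. [this work] -/
theorem fits_GN (hS : specOk S = true) (kind : ℕ) (m : Fin 8) :
    Fits (GN S kind m) (dGN S kind).y (dGN S kind).a (dGN S kind).b (dGN S kind).c := by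
  unfold GN dGN
  split_ifs with hk
  · simp only [specOk, Bool.and_eq_true, List.all_eq_true, List.mem_finRange, forall_const] at hS
    exact fits_of_fitsB _ _ (hS.1 ⟨kind, hk⟩ m)
  · exact fits_zero _ _ _ _

/-- The row tables fit their declared degrees under `specOk`. [this work] -/
theorem fits_HN (hS : specOk S = true) (k : ℕ) (m m' : Fin 8) :
    Fits (HN S k m m') (dHN S k).y (dHN S k).a (dHN S k).b (dHN S k).c := by
  unfold HN dHN
  split_ifs with hk
  · simp only [specOk, Bool.and_eq_true, List.all_eq_true, List.mem_finRange, forall_const] at hS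
    exact fits_of_fitsB _ _ (hS.2 ⟨k, hk⟩ m m')
  · exact fits_zero _ _ _ _

/-! ## The real value of the assembled tensor -/

/-- Real contribution of one entry to the coefficient of `v m · v m'`. -/
noncomputable def condE (en : Entry) (m m' : Fin 8) : ℝ :=
  if en.kind ≤ 4 then
    (if en.idx = m.val then wt d en y a b c * ev (GN S en.kind m') y a b c else 0) +
      (if en.idx = m'.val ∧ m ≠ m' then wt d en y a b c * ev (GN S en.kind m) y a b c else 0)
  else if en.kind = 5 then wt d en y a b c * ev (HN S en.idx m m') y a b c
  else 0

/-- A structurally absent table evaluates to `0`. [this work] -/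
theorem ev_eq_zero_of_isZero (t : P4 ℤ) (h : (V432.ofP4 t).isZero = true) : ev t y a b c = 0 := by
  have ht : t = BoxPolyP.zero := by rw [← V432.toP4_ofP4 t]; exact V432.toP4_eq_zero_of_isZero _ h
  rw [ht]; exact ev_zero y a b c

/-- `ev (term …) = mu · fac · ev table`. [this work] -/
theorem ev_term (en : Entry) (t : P4 ℤ) {D : Deg} (ht : Fits t D.y D.a D.b D.c) (he : degOk D en.e = true) :
    ev (term d en t) y a b c = wt d en y a b c * ev t y a b c := by
  unfold term wt
  split_ifs with hz
  · rw [ev_zero, ev_eq_zero_of_isZero y a b c t hz, mul_zero]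
  · rw [ev_smul, ev_monoMul y a b c d ht en.e he]; push_cast; ring

/-- `ev (contrib …) = condE` for a well-formed entry. [this work] -/
theorem ev_contrib (hS : specOk S = true) (en : Entry) (hen : entryOk S en = true) (m m' : Fin 8) :
    ev (contrib S d en m m') y a b c = condE y a b c d S en m m' := by
  simp only [entryOk, Bool.and_eq_true, Bool.or_eq_true, decide_eq_true_eq] at hen
  obtain ⟨_, hk⟩ := hen
  unfold contrib condE
  rcases hk with ⟨⟨hk4, _⟩, hdeg⟩ | ⟨⟨hk5, _⟩, hdeg⟩
  · rw [if_pos hk4, if_pos hk4]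
    split_ifs <;> simp only [ev_add, ev_zero, ev_term y a b c d en _ (fits_GN S hS en.kind _) hdeg]
  · have hk4 : ¬ en.kind ≤ 4 := by omega
    rw [if_neg hk4, if_neg hk4, if_pos hk5, if_pos hk5, ev_term y a b c d en _ (fits_HN S hS en.idx m m') hdeg]

/-- `ev` of the folded sum of contributions. [this work] -/
theorem ev_foldr (hS : specOk S = true) (m m' : Fin 8) (L : List Entry) (hL : ∀ en ∈ L, entryOk S en = true) :
    ev (L.foldr (fun en acc => add (contrib S d en m m') acc) BoxPolyP.zero) y a b c = (L.map fun en => condE y a b c d S en m m').sum := by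
  induction L with
  | nil => simp [ev_zero]
  | cons en L ih =>
    simp only [List.foldr_cons, List.map_cons, List.sum_cons]
    rw [ev_add, ev_contrib y a b c d S hS en (hL en (by simp)) m m', ih (fun en' hen' => hL en' (by simp [hen']))]

/-- **`ev (polyOf S d m m') = Σ condE`.** [this work] -/
theorem ev_polyOf (hS : specOk S = true) (hL : ∀ en ∈ d.entries, entryOk S en = true) (m m' : Fin 8) :
    ev (polyOf S d m m') y a b c = (d.entries.map fun en => condE y a b c d S en m m').sum :=
  ev_foldr y a b c d S hS m m' d.entries hL

end Real

/-! ## The record bridge -/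

variable (d : Cert) (S : Spec)

/-- `toP4 ∘ mulYV = mulY ∘ toP4`. [this work] -/
theorem toP4_mulYV (x : V432) : V432.toP4 (mulYV d x) = mulY d (V432.toP4 x) := by
  unfold mulYV mulY; rw [V432.toP4_lin, V432.toP4_shiftY]
/-- `toP4 ∘ mulAV = mulA ∘ toP4`. [this work] -/
theorem toP4_mulAV (x : V432) : V432.toP4 (mulAV d x) = mulA d (V432.toP4 x) := by
  unfold mulAV mulA; rw [V432.toP4_lin, V432.toP4_shiftA]
/-- `toP4 ∘ mulBV = mulB ∘ toP4`. [this work] -/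
theorem toP4_mulBV (x : V432) : V432.toP4 (mulBV d x) = mulB d (V432.toP4 x) := by
  unfold mulBV mulB; rw [V432.toP4_lin, V432.toP4_shiftB]
/-- `toP4 ∘ mulCV = mulC ∘ toP4`. [this work] -/
theorem toP4_mulCV (x : V432) : V432.toP4 (mulCV d x) = mulC d (V432.toP4 x) := by
  unfold mulCV mulC; rw [V432.toP4_lin, V432.toP4_shiftC]

/-- `toP4 ∘ monoMulV e = monoMul e ∘ toP4`. [this work] -/
theorem toP4_monoMulV (e : ℕ) (x : V432) : V432.toP4 (monoMulV d e x) = monoMul d e (V432.toP4 x) := by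
  unfold monoMulV monoMul powYV powY optAV optA optBV optB optCV optC
  split_ifs <;> simp only [toP4_mulYV, toP4_mulAV, toP4_mulBV, toP4_mulCV]

/-- `toP4 (termV … acc) = add (term …) (toP4 acc)`. [this work] -/
theorem toP4_termV (en : Entry) (t : P4 ℤ) (acc : V432) : V432.toP4 (termV d en t acc) = add (term d en t) (V432.toP4 acc) := by
  by_cases hz : (V432.ofP4 t).isZero = true
  · have e1 : termV d en t acc = acc := by simp [termV, hz]
    have e2 : term d en t = BoxPolyP.zero := by simp [term, hz]
    rw [e1, e2]; funext i j k l; simp [BoxPolyP.add, BoxPolyP.zero]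
  · have e1 : termV d en t acc = V432.addSmul (en.mu : ℤ) (monoMulV d en.e (V432.ofP4 t)) acc := by simp [termV, hz]
    have e2 : term d en t = smul (en.mu : ℤ) (monoMul d en.e t) := by simp [term, hz]
    rw [e1, e2, V432.toP4_addSmul, toP4_monoMulV, V432.toP4_ofP4]

/-- `toP4 (stepV … acc) = add (contrib …) (toP4 acc)`. [this work] -/
theorem toP4_stepV (en : Entry) (m m' : Fin 8) (acc : V432) :
    V432.toP4 (stepV S d en m m' acc) = add (contrib S d en m m') (V432.toP4 acc) := by
  unfold stepV contrib
  split_ifs <;> (funext i j k l; simp only [toP4_termV, BoxPolyP.add, BoxPolyP.zero]) <;> first | rfl | ring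

/-- **`toP4 (polyOfV …) = polyOf …`.** [this work] -/
theorem toP4_polyOfV (m m' : Fin 8) : V432.toP4 (polyOfV S d m m') = polyOf S d m m' := by
  unfold polyOfV polyOf
  induction d.entries with
  | nil => exact V432.toP4_zero
  | cons en L ih => simp only [List.foldr_cons]; rw [toP4_stepV, ih]

/-- **The kernel step.** If `pairOk S d (m, m')` then `ev (polyOf S d m m') ≤ 0` at every real point of the certificate's box. [this work] -/
theorem ev_polyOf_nonpos (m m' : Fin 8) (hok : pairOk S d (m, m') = true) (hD : 0 < d.D) (y a b c : ℝ)
    (hy0 : (d.Y0 : ℝ) ≤ (d.D : ℝ) * y) (hy1 : (d.D : ℝ) * y ≤ d.Y1) (ha0 : (d.A0 : ℝ) ≤ (d.D : ℝ) * a) (ha1 : (d.D : ℝ) * a ≤ d.A1)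
    (hb0 : (d.B0 : ℝ) ≤ (d.D : ℝ) * b) (hb1 : (d.D : ℝ) * b ≤ d.B1) (hc0 : (d.C0 : ℝ) ≤ (d.D : ℝ) * c) (hc1 : (d.D : ℝ) * c ≤ d.C1) :
    ev (polyOf S d m m') y a b c ≤ 0 := by
  have h1 := (V432.nonpos_iff _).1 hok
  simp only [V432.toP4_ctrlF, toP4_polyOfV] at h1
  have hD' : (0 : ℤ) < (d.D : ℤ) := by exact_mod_cast hD
  have := nonpos4_int d.Y0 d.Y1 d.A0 d.A1 d.B0 d.B1 d.C0 d.C1 (d.D : ℤ) (polyOf S d m m') hD' h1 y a b c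
    (by push_cast; exact hy0) (by push_cast; exact hy1) (by push_cast; exact ha0) (by push_cast; exact ha1)
    (by push_cast; exact hb0) (by push_cast; exact hb1) (by push_cast; exact hc0) (by push_cast; exact hc1)
  exact this

end CertN

end Quant

end Summit.CriticalPhenomena.PercolationContinuityZ3.Theorems
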